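import Summits.Langlands.Langlands.Theorems.AbelianSurfaceSerreQuadraticImprimitiveSurfacesCliffordInduced
import Summits.Langlands.Langlands.Theorems.AbelianSurfaceSerreQuadraticImprimitiveSurfacesCliffordMackey
import HarnessLib

/-!
# Clifford–Mackey in index two for framed (Galois) representations: quadratically imprimitive
# ⟹ induced from a NON-conjugate-invariant representation

Crux `AbelianSurfaceSerre.QuadraticImprimitiveSurfaces` (stmt-Langlands-17766), `--supports` helpers
(companion of `…CliffordInduced.lean`, whose construction is repeated, and `…CliffordMackey.lean`,
the abstract multiplicity-one half `Hom_N(U, π(g)U) = 0`).  Everything here is PROVED: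

* `exists_charpoly_eq_charpoly_comp_indMatrix_and_hom_conj_eq_zero` — framed form over an
  algebraically closed topological field: `r` irreducible, `r ∘ φ` reducible, `[G : φ(H)] = 2` ⟹
  `r` has the characteristic polynomials of `Ind s` with `s` irreducible AND
  `Hom_H(s, s^{g₀}) = 0 = Hom_H(s^{g₀}, s)` for every `g₀ ∉ φ(H)` (no non-zero intertwining matrix);
* `exists_charpoly_eq_charpoly_induce_and_hom_conj_eq_zero` — quadratic extensions of number fields;
* `exists_rank_two_charpoly_eq_charpoly_induce_and_hom_conj_eq_zero` — rank `4` over `ℚ`: the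
  crux's shape (`r = (V_p A)^∨`, irreducible by Faltings when `End_ℚ(A) = ℤ`): `r ∼ Ind_{Γ_K}^{Γ_ℚ} s`,
  `s : Γ_K → GL₂` irreducible with `s ≇ s^σ` — the cuspidality input of `AI_K^ℚ` in every `GL₂/K`
  approach and the shape `ρ̄ = Ind σ̄`, `σ̄ ≇ σ̄^c` of a wreath residue (BCGP 2025 §10.4, type B[C₂]).

References: A. H. Clifford, Ann. of Math. 38 (1937), Thm. 1–2 [Clifford1937]; J.-P. Serre, *Linear
representations of finite groups*, §7.3 Prop. 22, §7.4 Prop. 23 [SerreLinearRepresentations1977].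
-/

noncomputable section

set_option linter.dupNamespace false

namespace Summit.Langlands.Langlands.Cruxes.QuadraticImprimitiveSurfaces.Clifford

/-! ### Framed representations: the inducing representation is not conjugate-invariant -/

section Framed

open scoped MatrixGroups

open Literature.NumberTheory.GaloisRepresentations

variable {G H : Type*} [Group G] [TopologicalSpace G] [Group H] [TopologicalSpace H]
  [IsTopologicalGroup H] {A : Type*} [Field A] [IsAlgClosed A] [TopologicalSpace A]
  [IsTopologicalRing A] {n : ℕ}

/-- **Clifford, index two, framed form — with Mackey's condition.**  Over an ALGEBRAICALLY CLOSED
topological field `A`: for `r : G →ₜ* GL_n(A)` irreducible, `φ : H →ₜ* G` injective with image `N`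
of index `2` and `r ∘ φ` not irreducible, `n = 2m` and there is an irreducible `s : H →ₜ* GL_m(A)`
with `det(X - r(x)) = det(X - Ind(s)(x))` for every transversal (as in
`exists_charpoly_eq_charpoly_comp_indMatrix`, whose construction is repeated verbatim: `s` is the
frame of the Clifford component `U`), AND `s` is not `G`-conjugate-invariant in the strong sense
`Hom_H(s, s^{g₀}) = 0 = Hom_H(s^{g₀}, s)` for every `g₀ ∉ N`: a matrix `P` with
`P · s(h) = s(h') · P` (resp. `P · s(h') = s(h) · P`) whenever `φ(h') = g₀⁻¹ φ(h) g₀` is zero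
(`eq_zero_of_range_le_map_of_index_two` applied to `u ↦ r(g₀) P u`, an `H`-map `U → r(g₀)U`).
[cite: Clifford1937, Thm. 1–2] [cite: SerreLinearRepresentations1977, §7.3 Prop. 22, §7.4 Prop. 23] -/
theorem exists_charpoly_eq_charpoly_comp_indMatrix_and_hom_conj_eq_zero (r : FramedRep G A n)
    (hirr : r.IsIrreducible) (φ : H →ₜ* G) (hinj : Function.Injective φ)
    (hφ : φ.toMonoidHom.range.index = 2) (hred : ¬ FramedRep.IsIrreducible (r.comp φ)) :
    ∃ (m : ℕ) (s : FramedRep H A m), n = 2 * m ∧ s.IsIrreducible ∧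
      (∀ {ι : Type*} [Fintype ι] [DecidableEq ι] (t : ι → G),
        Function.Bijective (fun i => (t i : G ⧸ φ.toMonoidHom.range)) →
        ∀ x : G, FramedRep.charpoly r x =
          (Matrix.comp ι ι (Fin m) (Fin m) A
            (indMatrix φ.toMonoidHom (FramedRep.toMatrixHom s) t x)).charpoly) ∧
      ∀ g₀ : G, g₀ ∉ φ.toMonoidHom.range → ∀ P : Matrix (Fin m) (Fin m) A,
        ((∀ h h' : H, φ h' = g₀⁻¹ * φ h * g₀ →
            P * ((s h : GL (Fin m) A) : Matrix (Fin m) (Fin m) A) =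
              ((s h' : GL (Fin m) A) : Matrix (Fin m) (Fin m) A) * P) → P = 0) ∧
        ((∀ h h' : H, φ h' = g₀⁻¹ * φ h * g₀ →
            P * ((s h' : GL (Fin m) A) : Matrix (Fin m) (Fin m) A) =
              ((s h : GL (Fin m) A) : Matrix (Fin m) (Fin m) A) * P) → P = 0) := by
  classical
  -- adapted from `exists_charpoly_eq_charpoly_comp_indMatrix` (…CliffordInduced.lean): same
  -- Clifford component `W`, same frame `s`; the last conjunct is new.
  set ρ := r.toRepresentation with hρdef
  set N : Subgroup G := φ.toMonoidHom.range with hNdef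
  obtain ⟨W, hWb, hWt, hW⟩ := exists_isCompl_of_not_isIrreducible_comp ρ hirr
    φ.toMonoidHom hφ (by rwa [← framedRep_toRepresentation_comp])
  obtain ⟨g₀, hg₀⟩ : ∃ g : G, g ∉ N := by
    by_contra! h
    have htop : N = ⊤ := eq_top_iff.mpr fun x _ => h x
    rw [htop, Subgroup.index_top] at hφ
    exact absurd hφ (by norm_num)
  obtain ⟨hinf, hsup⟩ := hW g₀ hg₀
  set U : Submodule A (Fin n → A) := W.toSubmodule with hUdef
  haveI : IsModuleTopology A U := TwistedSum.isModuleTopology_submodule_pi U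
  let σU : ContinuousRep H A U := ⟨W.toRepresentation, by
    rw [Topology.IsInducing.subtypeVal.continuous_iff]
    change Continuous fun q : H × U =>
      ((r (φ q.1) : GL (Fin n) A) : Matrix (Fin n) (Fin n) A).mulVec (q.2 : Fin n → A)
    exact ((Units.continuous_val.comp ((map_continuous r).comp
      ((map_continuous φ).comp continuous_fst))).matrix_mulVec
      (continuous_subtype_val.comp continuous_snd))⟩
  set m := Module.finrank A U with hmdef
  let bU : Module.Basis (Fin m) A U := Module.finBasis A U
  let s : FramedRep H A m := σU.frame bU
  have hs_coe : ∀ h : H, ((s h : GL (Fin m) A) : Matrix (Fin m) (Fin m) A) =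
      LinearMap.toMatrix bU bU (W.toRepresentation h) := fun h => rfl
  have hinj' : Function.Injective φ.toMonoidHom := hinj
  haveI hNn : N.Normal := Subgroup.normal_of_index_eq_two hφ
  have hmul : ∀ {a b : G}, a ∉ N → b ∉ N → a * b ∈ N := fun ha hb =>
    (Subgroup.mul_mem_iff_of_index_two hφ).mpr (iff_of_false ha hb)
  refine ⟨m, s, ?_, ?_, ?_, ?_⟩
  · -- `n = 2m`
    have h := finrank_eq_two_mul_of_isCompl_map ρ hinf hsup
    rwa [Module.finrank_fin_fun] at h
  · -- `s` is irreducible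
    haveI : W.toRepresentation.IsIrreducible :=
      isIrreducible_toRepresentation_of_index_two ρ hirr φ.toMonoidHom hφ W hWb hg₀ hinf
    exact Literature.RepresentationTheory.Semisimple.Representation.isIrreducible_of_equiv
      (σU.frameEquiv bU).toRepEquiv.symm
  · -- characteristic polynomials (verbatim from `…CliffordInduced`)
    have hc : IsCompl U (U.map (ρ g₀)) := ⟨disjoint_iff.mpr hinf, codisjoint_iff.mpr hsup⟩
    let eU : U ≃ₗ[A] U.map (ρ g₀) :=
      Submodule.equivMapOfInjective (ρ g₀) (representation_apply_injective ρ g₀) U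
    let bU' : Module.Basis (Fin m) A (U.map (ρ g₀)) := bU.map eU
    let B : Module.Basis (Bool × Fin m) A (Fin n → A) :=
      ((bU.prod bU').map (Submodule.prodEquivOfIsCompl _ _ hc)).reindex
        (Equiv.boolProdEquivSum (Fin m)).symm
    let t₀ : Bool → G := fun c => bif c then g₀ else 1
    have hB : ∀ (i : Bool) (a : Fin m), B (i, a) = ρ (t₀ i) (bU a : Fin n → A) := by
      intro i a
      cases i
      · simp [B, t₀, Module.Basis.reindex_apply, Module.Basis.map_apply, Module.Basis.prod_apply,
          Submodule.coe_prodEquivOfIsCompl']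
      · simp [B, t₀, bU', eU, Module.Basis.reindex_apply, Module.Basis.map_apply,
          Module.Basis.prod_apply, Submodule.coe_prodEquivOfIsCompl']
    have ht₀ : Function.Bijective (fun i => (t₀ i : G ⧸ N)) := by
      constructor
      · intro i j hij
        have hij' : (t₀ i)⁻¹ * t₀ j ∈ N := QuotientGroup.eq.mp hij
        cases i <;> cases j
        · rfl
        · exact absurd (by simpa [t₀] using hij') hg₀
        · exfalso
          have : g₀⁻¹ ∈ N := by simpa [t₀] using hij'
          exact hg₀ (by simpa using N.inv_mem this)
        · rfl
      · intro q
        induction q using QuotientGroup.induction_on with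
        | H x =>
          by_cases hx : x ∈ N
          · exact ⟨false, QuotientGroup.eq.mpr (by simpa [t₀] using hx)⟩
          · refine ⟨true, QuotientGroup.eq.mpr ?_⟩
            have : g₀⁻¹ ∉ N := fun h => hg₀ (by simpa using N.inv_mem h)
            simpa [t₀] using hmul this hx
    have hcol : ∀ (h : H) (b : Fin m),
        ρ (φ h) (bU b : Fin n → A) =
          ∑ c, (LinearMap.toMatrix bU bU (W.toRepresentation h)) c b • (bU c : Fin n → A) := by
      intro h b
      have h1 : W.toRepresentation h (bU b) =
          ∑ c, (LinearMap.toMatrix bU bU (W.toRepresentation h)) c b • bU c := by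
        conv_lhs => rw [← Matrix.toLin_toMatrix bU bU (W.toRepresentation h)]
        rw [Matrix.toLin_self]
      have h2 : ρ (φ h) (bU b : Fin n → A) = ((W.toRepresentation h (bU b) : U) : Fin n → A) := rfl
      rw [h2, h1]
      simp
    have hmat : ∀ x : G, LinearMap.toMatrix B B (ρ x) =
        Matrix.comp Bool Bool (Fin m) (Fin m) A
          (indMatrix φ.toMonoidHom (FramedRep.toMatrixHom s) t₀ x) := by
      intro x
      ext ⟨i, a⟩ ⟨j, b⟩
      obtain ⟨i₀, hi₀⟩ := ht₀.2 ((x * t₀ j : G) : G ⧸ N)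
      have hmem : (t₀ i₀)⁻¹ * (x * t₀ j) ∈ N := QuotientGroup.eq.mp hi₀
      obtain ⟨h, hh⟩ := hmem
      have hxB : ρ x (B (j, b)) =
          ∑ c, (LinearMap.toMatrix bU bU (W.toRepresentation h)) c b • B (i₀, c) := by
        rw [hB j b, ← Module.End.mul_apply, ← map_mul,
          show x * t₀ j = t₀ i₀ * φ.toMonoidHom h by rw [hh]; group, map_mul, Module.End.mul_apply,
          show (φ.toMonoidHom h : G) = φ h from rfl, hcol h b, map_sum]
        refine Finset.sum_congr rfl fun c _ => ?_
        rw [map_smul, hB i₀ c]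
      rw [LinearMap.toMatrix_apply, hxB, map_sum, Finsupp.finsetSum_apply]
      simp only [map_smul, Finsupp.smul_apply, Module.Basis.repr_self, Finsupp.single_apply,
        Prod.mk.injEq, smul_eq_mul, mul_ite, mul_one, mul_zero]
      rw [Matrix.comp_apply, indMatrix_apply]
      by_cases hi : i = i₀
      · subst hi
        rw [show (t₀ i)⁻¹ * x * t₀ j = φ.toMonoidHom h by rw [hh, mul_assoc],
          dotExtend_apply_map hinj', FramedRep.toMatrixHom_apply, hs_coe]
        simp [eq_comm]
      · have hnot : (t₀ i)⁻¹ * x * t₀ j ∉ N := by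
          intro hin
          apply hi
          apply ht₀.1
          change (t₀ i : G ⧸ N) = (t₀ i₀ : G ⧸ N)
          have h1 : (t₀ i : G ⧸ N) = (x * t₀ j : G) :=
            QuotientGroup.eq.mpr (by rwa [mul_assoc] at hin)
          have h2 : (t₀ i₀ : G ⧸ N) = (x * t₀ j : G) := hi₀
          exact h1.trans h2.symm
        rw [dotExtend_of_not_mem _ _ hnot, Matrix.zero_apply]
        simp [Ne.symm hi]
    intro ι _ _ t ht x
    rw [charpoly_comp_indMatrix_eq_of_transversal hinj' (FramedRep.toMatrixHom s) ht₀ ht x,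
      ← hmat x, LinearMap.charpoly_toMatrix, FramedRep.charpoly_eq_charpoly_toRepresentation]
  · -- Mackey: `Hom_H(s, s^{g}) = 0` and `Hom_H(s^{g}, s) = 0` for every `g ∉ N` (new)
    -- one direction, for an arbitrary `g ∉ N`
    have key : ∀ g : G, g ∉ N → ∀ P : Matrix (Fin m) (Fin m) A,
        (∀ h h' : H, φ h' = g⁻¹ * φ h * g →
          P * ((s h : GL (Fin m) A) : Matrix (Fin m) (Fin m) A) =
            ((s h' : GL (Fin m) A) : Matrix (Fin m) (Fin m) A) * P) → P = 0 := by
      intro g hg P hP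
      -- `θ = P` as an endomorphism of `U`, `ψ = ρ(g) ∘ θ : U → V`
      let θ : U →ₗ[A] U := Matrix.toLin bU bU P
      have hθ : ∀ (h h' : H), φ h' = g⁻¹ * φ h * g → ∀ u : U,
          θ (W.toRepresentation h u) = W.toRepresentation h' (θ u) := by
        intro h h' hhh' u
        have h1 := congrArg (Matrix.toLin bU bU) (hP h h' hhh')
        rw [Matrix.toLin_mul bU bU bU, Matrix.toLin_mul bU bU bU, hs_coe, hs_coe,
          Matrix.toLin_toMatrix, Matrix.toLin_toMatrix] at h1
        exact congrArg (fun f => f u) h1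
      let ψ : U →ₗ[A] (Fin n → A) := (ρ g) ∘ₗ U.subtype ∘ₗ θ
      have hψ : ∀ (h : H) (w : U), ψ (W.toRepresentation h w) = ρ (φ.toMonoidHom h) (ψ w) := by
        intro h w
        obtain ⟨h', hh'⟩ : g⁻¹ * φ h * g ∈ N := by
          simpa using hNn.conj_mem (φ h) ⟨h, rfl⟩ g⁻¹
        have hgh : g * φ h' = φ h * g := by
          rw [show (φ h' : G) = φ.toMonoidHom h' from rfl, hh']; group
        change ρ g ((θ (W.toRepresentation h w) : U) : Fin n → A) =
          ρ (φ h) (ρ g ((θ w : U) : Fin n → A))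
        rw [hθ h h' (by rw [show (φ h' : G) = φ.toMonoidHom h' from rfl, hh']) w,
          show ((W.toRepresentation h' (θ w) : U) : Fin n → A) = ρ (φ h') ((θ w : U) : Fin n → A)
            from rfl,
          ← Module.End.mul_apply, ← map_mul, hgh, map_mul, Module.End.mul_apply]
      have hr : LinearMap.range ψ ≤ U.map (ρ g) := by
        rintro _ ⟨w, rfl⟩
        exact Submodule.mem_map_of_mem (θ w).2
      have h0 := eq_zero_of_range_le_map_of_index_two ρ hirr φ.toMonoidHom hφ W hWt hg ψ hψ hr
      have hθ0 : θ = 0 := by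
        apply LinearMap.ext
        intro w
        have h1 : ρ g ((θ w : U) : Fin n → A) = 0 := by
          have := congrArg (fun f : U →ₗ[A] (Fin n → A) => f w) h0
          simpa [ψ] using this
        have h2 : ((θ w : U) : Fin n → A) = 0 :=
          representation_apply_injective ρ g (by rw [h1, map_zero])
        rw [LinearMap.zero_apply]
        exact Subtype.ext (by simpa using h2)
      have : P = LinearMap.toMatrix bU bU θ := (LinearMap.toMatrix_toLin bU bU P).symm
      rw [this, hθ0, map_zero]
    intro g hg P
    refine ⟨key g hg P, fun hP => ?_⟩
    -- the other direction is the first one for `g⁻¹`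
    have hginv : g⁻¹ ∉ N := fun h => hg (by simpa using N.inv_mem h)
    refine key g⁻¹ hginv P fun h h' hhh' => ?_
    refine hP h' h ?_
    rw [hhh']; group

end Framed

/-! ### Galois representations: quadratically imprimitive ⟹ induced from a NON-conjugate-invariant `s` -/

section Galois

open Literature.NumberTheory.GaloisRepresentations Field

universe u

variable (K : Type u) {L : Type*} [Field K] [NumberField K] [Field L] [Algebra K L]
  [FiniteDimensional K L] {A : Type*} [Field A] [IsAlgClosed A] [TopologicalSpace A]
  [IsTopologicalRing A] {n : ℕ}

/-- **Clifford–Mackey for a quadratic extension of number fields.**  Let `L/K` be quadratic and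
`r : Γ_K → GL_n(A)` an irreducible framed Galois representation over an algebraically closed
topological field `A` whose restriction to `Γ_L` is not irreducible.  Then `n = 2m` and
`r ≅ Ind_{Γ_L}^{Γ_K} s` at the level of characteristic polynomials for an irreducible
`s : Γ_L → GL_m(A)` (as in `exists_charpoly_eq_charpoly_induce_of_not_isIrreducible_restrictField`)
which moreover is NOT `Gal(L/K)`-conjugate-invariant: for every `σ₀ ∈ Γ_K ∖ Γ_L` there is no
non-zero matrix intertwining `s` with `s^{σ₀} : h ↦ s(σ₀⁻¹ h σ₀)` in either direction (pairs
`(h, h')` with `h' = σ₀⁻¹ h σ₀` computed in `Γ_K` along the tree's `absGaloisRestrict K L`).  This is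
the Galois-side cuspidality condition (`s ≇ s^σ`) for the automorphic induction `AI_L^K`.
[cite: Clifford1937, Thm. 1–2] [cite: SerreLinearRepresentations1977, §7.3 Prop. 22, §7.4 Prop. 23] -/
theorem exists_charpoly_eq_charpoly_induce_and_hom_conj_eq_zero
    (hd : Module.finrank K L = 2) (r : FramedGaloisRep K A n) (hirr : FramedRep.IsIrreducible r)
    (hred : ¬ FramedRep.IsIrreducible (r.restrictField L)) :
    ∃ (m : ℕ) (s : FramedGaloisRep L A m), n = 2 * m ∧ FramedRep.IsIrreducible s ∧
      (∀ σ : absoluteGaloisGroup K,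
        FramedRep.charpoly r σ = FramedRep.charpoly (s.induce K hd) σ) ∧
      ∀ σ₀ : absoluteGaloisGroup K, σ₀ ∉ (absGaloisRestrict K L).toMonoidHom.range →
        ∀ P : Matrix (Fin m) (Fin m) A,
          ((∀ h h' : absoluteGaloisGroup L,
              absGaloisRestrict K L h' = σ₀⁻¹ * absGaloisRestrict K L h * σ₀ →
              P * ((s h : GL (Fin m) A) : Matrix (Fin m) (Fin m) A) =
                ((s h' : GL (Fin m) A) : Matrix (Fin m) (Fin m) A) * P) → P = 0) ∧
          ((∀ h h' : absoluteGaloisGroup L,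
              absGaloisRestrict K L h' = σ₀⁻¹ * absGaloisRestrict K L h * σ₀ →
              P * ((s h' : GL (Fin m) A) : Matrix (Fin m) (Fin m) A) =
                ((s h : GL (Fin m) A) : Matrix (Fin m) (Fin m) A) * P) → P = 0) := by
  have hidx : (absGaloisRestrict K L).toMonoidHom.range.index = 2 := by
    rw [← hd]
    exact nat_card_quotient_range_absGaloisRestrict K L
  obtain ⟨m, s, hm, hs, hchar, hconj⟩ :=
    exists_charpoly_eq_charpoly_comp_indMatrix_and_hom_conj_eq_zero r hirr
      (absGaloisRestrict K L) (absGaloisRestrict_injective K L) hidx hred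
  refine ⟨m, s, hm, hs, fun σ => ?_, hconj⟩
  rw [FramedGaloisRep.charpoly_induce_eq_charpoly_comp_indMatrix K hd s σ]
  exact hchar (absGaloisCosetRep K L hd) (absGaloisCosetRep_bijective K L hd) σ

end Galois

section RankFour

/-- **Rank four over `ℚ` (the shape used by crux `QuadraticImprimitiveSurfaces`), with Mackey's
condition.**  Over an algebraically closed topological field `A` (e.g. `ℚ̄_p = PadicAlgCl p`, or
`𝔽̄_p` for a residual representation), an irreducible `r : Γ_ℚ → GL₄(A)` which becomes reducible on
`Γ_K` for a quadratic number field `K` has the characteristic polynomials of `Ind_{Γ_K}^{Γ_ℚ} s` for an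
irreducible `s : Γ_K → GL₂(A)` with `s ≇ s^σ` (no non-zero intertwiner with its `Gal(K/ℚ)`-conjugate,
either direction).  For `r = (V_p A)^∨ ⊗ ℚ̄_p` of an abelian surface with `End_ℚ(A) = ℤ`
(irreducible by Faltings) this is the input "`A_K` of `GL₂`-type with non-Galois-invariant `λ`-adic
piece" of every `GL₂/K` approach (cuspidality of `AI_K^ℚ`), and with `A = 𝔽̄_p` the shape
`ρ̄ = Ind σ̄`, `σ̄ ≇ σ̄^c` of a wreath residue. [cite: Clifford1937, Thm. 1–2] -/
theorem exists_rank_two_charpoly_eq_charpoly_induce_and_hom_conj_eq_zero {A : Type} [Field A]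
    [IsAlgClosed A] [TopologicalSpace A] [IsTopologicalRing A]
    (r : Literature.NumberTheory.GaloisRepresentations.FramedGaloisRep ℚ A 4)
    (hirr : Literature.NumberTheory.GaloisRepresentations.FramedRep.IsIrreducible r) (K : Type)
    [Field K] [NumberField K] (hK : Module.finrank ℚ K = 2)
    (hred : ¬ Literature.NumberTheory.GaloisRepresentations.FramedRep.IsIrreducible
      (r.restrictField K)) :
    ∃ s : Literature.NumberTheory.GaloisRepresentations.FramedGaloisRep K A 2,
      Literature.NumberTheory.GaloisRepresentations.FramedRep.IsIrreducible s ∧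
      (∀ σ : Field.absoluteGaloisGroup ℚ,
        Literature.NumberTheory.GaloisRepresentations.FramedRep.charpoly r σ =
          Literature.NumberTheory.GaloisRepresentations.FramedRep.charpoly (s.induce ℚ hK) σ) ∧
      ∀ σ₀ : Field.absoluteGaloisGroup ℚ,
        σ₀ ∉ (Literature.NumberTheory.GaloisRepresentations.absGaloisRestrict ℚ K).toMonoidHom.range →
        ∀ P : Matrix (Fin 2) (Fin 2) A,
          ((∀ h h' : Field.absoluteGaloisGroup K,
              Literature.NumberTheory.GaloisRepresentations.absGaloisRestrict ℚ K h' =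
                σ₀⁻¹ * Literature.NumberTheory.GaloisRepresentations.absGaloisRestrict ℚ K h * σ₀ →
              P * ((s h : GL (Fin 2) A) : Matrix (Fin 2) (Fin 2) A) =
                ((s h' : GL (Fin 2) A) : Matrix (Fin 2) (Fin 2) A) * P) → P = 0) ∧
          ((∀ h h' : Field.absoluteGaloisGroup K,
              Literature.NumberTheory.GaloisRepresentations.absGaloisRestrict ℚ K h' =
                σ₀⁻¹ * Literature.NumberTheory.GaloisRepresentations.absGaloisRestrict ℚ K h * σ₀ →
              P * ((s h' : GL (Fin 2) A) : Matrix (Fin 2) (Fin 2) A) =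
                ((s h : GL (Fin 2) A) : Matrix (Fin 2) (Fin 2) A) * P) → P = 0) := by
  obtain ⟨m, s, hm, hs, hchar, hconj⟩ :=
    exists_charpoly_eq_charpoly_induce_and_hom_conj_eq_zero ℚ hK r hirr hred
  obtain rfl : m = 2 := by omega
  exact ⟨s, hs, hchar, hconj⟩

end RankFour

end Summit.Langlands.Langlands.Cruxes.QuadraticImprimitiveSurfaces.Clifford
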